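import Literature.Geometry.Lorentzian.MeanCurvatureRegularity
import Literature.Geometry.Lorentzian.SecondFundamentalFormSymm
import Literature.Geometry.Lorentzian.IsometryProofs
import Literature.Geometry.Lorentzian.DataEmbeddingNormalSmooth
import Literature.Geometry.Lorentzian.InducedVacuumData
import Mathlib.Geometry.Manifold.VectorBundle.LocalFrame
import HarnessLib

/-!
# Induced initial data on a smooth spacelike hypersurface of a GENERAL data manifold

Supporting theorems for the re-slicing («slice gauge descent») of the route `RootDecompTrappedGauge`
(items `SliceHiddenTrappedExitR` / `TrappedGaugeDescentR` / `TrappedExit`): the packaging half of the door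
«a compactly supported smooth spacelike Cauchy re-slice of a Cauchy development carries an induced initial data set whose
future unit normal agrees with the old one off the gauge set».  Everything here is general Lorentzian / Riemannian
geometry over the tree's notions; no field equation and no route declaration is used.

* `bilin_eq_sum_basis`, `localFrame_eq_symmL`, `contMDiffAt_bilinSection_of_localFrame` — a smoothness criterion for a
  field of bilinear forms on `TN` by its components in the local frame of a tangent-bundle trivialisation;
* `contMDiff_bilinSection_secondFundamentalForm` — the second fundamental form `K_ν` of a smooth map `f : N → (M, g)` with
  smooth normal field `ν` is a `C^∞` section of `Hom(TN, Hom(TN, ℝ))` for a GENERAL manifold `N` (the tree's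
  `contMDiff_bilinSection_of_eq_secondFundamentalForm` is stated for chart domains `U : Opens E'`);
* `exists_initialDataSet_induced_manifold` — the induced initial data set `(f^* g, K_ν)` of a smooth spacelike immersion of
  a general boundaryless manifold (the tree's `InducedVacuumData.exists_initialDataSet_induced` is the chart-domain case);
* `dataEmbedding_normal_eq_of_embed_eq_off` — 1-jet locality + uniqueness of the future unit normal: a re-slice `ι`
  agreeing with the development's slice `ι₀` off a compact set has the same future unit normal there.

## References

* B. O'Neill, *Semi-Riemannian geometry*, Academic Press 1983, Ch. 4, Lemma 4 and Lemma 4.4 (shape tensor of a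
  semi-Riemannian submanifold, symmetric and smooth), Ch. 5, Lemma 5.26.
* Y. Choquet-Bruhat, *General relativity and the Einstein equations*, OUP 2009, Ch. VI, §2–3 (induced `(h, K)` on a
  spacelike hypersurface).
-/

noncomputable section

open Literature.Geometry.Lorentzian
open scoped Manifold ContDiff Topology
open Set Function Filter
open Bundle Manifold PseudoRiemannianMetric

set_option linter.dupNamespace false

namespace Summit.FinalStateConjecture.FinalStateConjecture.Theorems.SpacelikeSliceInducedData


/-! #### (β2-a) Smoothness of a field of bilinear forms on `TX` from its components in a local frame. -/
section BilinFrame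

variable {EX : Type*} [NormedAddCommGroup EX] [NormedSpace ℝ EX] [FiniteDimensional ℝ EX] {HX : Type*}
  [TopologicalSpace HX] {IX : ModelWithCorners ℝ EX HX} {N : Type*} [TopologicalSpace N] [ChartedSpace HX N]
  [IsManifold IX ∞ N]

/-- A continuous bilinear form on a finite-dimensional space is the sum of its matrix entries in a basis `b` times the
coordinate forms `(v, w) ↦ bⁱ(v) bʲ(w)`. [folklore] -/
theorem bilin_eq_sum_basis {ι : Type*} [Fintype ι] (b : Module.Basis ι ℝ EX) (B : EX →L[ℝ] EX →L[ℝ] ℝ) :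
    B = ∑ i, ∑ j, (B (b i) (b j)) • (ContinuousLinearMap.mul ℝ ℝ).bilinearComp
      (LinearMap.toContinuousLinearMap (b.coord i)) (LinearMap.toContinuousLinearMap (b.coord j)) := by
  ext v w
  simp only [FunLike.coe_sum, Finset.sum_apply, FunLike.coe_smul, Pi.smul_apply,
    ContinuousLinearMap.bilinearComp_apply, LinearMap.coe_toContinuousLinearMap', ContinuousLinearMap.mul_apply',
    smul_eq_mul, Module.Basis.coord_apply]
  conv_lhs => rw [← b.sum_repr v, ← b.sum_repr w]
  simp only [map_sum, map_smul, FunLike.coe_sum, Finset.sum_apply, FunLike.coe_smul,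
    Pi.smul_apply, smul_eq_mul, Finset.mul_sum]
  conv_lhs => rw [Finset.sum_comm]
  exact Finset.sum_congr rfl fun i _ ↦ Finset.sum_congr rfl fun j _ ↦ by ring

omit [FiniteDimensional ℝ EX] in
/-- The local frame of `TX` attached to the trivialisation `e` and the basis `b` is `e.symmL x (b i)` at EVERY point (both
sides vanish off the base set). [folklore] -/
theorem localFrame_eq_symmL {ι : Type*} (e : Trivialization EX (TotalSpace.proj : TangentBundle IX N → N))
    [MemTrivializationAtlas e] (b : Module.Basis ι ℝ EX) (i : ι) (x : N) :
    e.localFrame b i x = e.symmL ℝ x (b i) := by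
  by_cases hx : x ∈ e.baseSet
  · rw [e.localFrame_apply_of_mem_baseSet b hx, Trivialization.symmL_apply _ hx]
    simp [Trivialization.basisAt]
  · rw [e.localFrame_apply_of_notMem b hx, Trivialization.symmL_apply_of_notMem _ hx]

/-- **Smoothness criterion for a field of bilinear forms on `TX` by components in a local frame**: if every component
`x ↦ s_x(sᵢ x, sⱼ x)` in the local frame `sᵢ` of `TX` at `x₀` (trivialisation at `x₀`, basis `b` of the model fibre) is
`C^∞` at `x₀`, then `x ↦ s_x` is a `C^∞` section of `Hom(TX, Hom(TX, ℝ))` at `x₀` (read in the trivialisation,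
`contMDiffAt_bilin_iff`, the coordinate expression is `∑ᵢⱼ s_x(sᵢ x, sⱼ x) · bⁱ ⊗ bʲ`). [folklore] -/
theorem contMDiffAt_bilinSection_of_localFrame {ι : Type*} [Fintype ι] (b : Module.Basis ι ℝ EX)
    (s : Π x : N, TangentSpace IX x →L[ℝ] TangentSpace IX x →L[ℝ] ℝ) (x₀ : N)
    (h : ∀ i j, ContMDiffAt IX 𝓘(ℝ, ℝ) ∞ (fun x ↦ s x
        ((trivializationAt EX (TangentSpace IX : N → Type _) x₀).localFrame b i x)
        ((trivializationAt EX (TangentSpace IX : N → Type _) x₀).localFrame b j x)) x₀) :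
    ContMDiffAt IX (IX.prod 𝓘(ℝ, EX →L[ℝ] EX →L[ℝ] ℝ)) ∞
      (fun x ↦ TotalSpace.mk' (EX →L[ℝ] EX →L[ℝ] ℝ)
        (E := fun x : N ↦ TangentSpace IX x →L[ℝ] TangentSpace IX x →L[ℝ] ℝ) x (s x)) x₀ := by
  rw [contMDiffAt_bilin_iff]
  refine ⟨contMDiffAt_id, ?_⟩
  set e := trivializationAt EX (TangentSpace IX : N → Type _) x₀ with he
  have hL : (fun x ↦ (ContinuousLinearMap.precomp ℝ (e.symmL ℝ x)).comp ((s x).comp (e.symmL ℝ x))) =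
      fun x ↦ ∑ i, ∑ j, (s x (e.localFrame b i x) (e.localFrame b j x)) •
        (ContinuousLinearMap.mul ℝ ℝ).bilinearComp
          (LinearMap.toContinuousLinearMap (b.coord i)) (LinearMap.toContinuousLinearMap (b.coord j)) := by
    funext x
    rw [bilin_eq_sum_basis b ((ContinuousLinearMap.precomp ℝ (e.symmL ℝ x)).comp ((s x).comp (e.symmL ℝ x)))]
    simp only [ContinuousLinearMap.coe_comp, Function.comp_apply, ContinuousLinearMap.precomp_apply,
      localFrame_eq_symmL]
  rw [hL]
  exact ContMDiffAt.sum fun i _ ↦ ContMDiffAt.sum fun j _ ↦ (h i j).smul contMDiffAt_const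

end BilinFrame

/-! #### (β2-b) The induced initial data set of a spacelike immersion of a GENERAL manifold. -/
section InducedData

variable {E : Type*} [NormedAddCommGroup E] [NormedSpace ℝ E] {H : Type*} [TopologicalSpace H]
  {I : ModelWithCorners ℝ E H} {M : Type*} [TopologicalSpace M] [ChartedSpace H M]
  [IsManifold I ∞ M] [FiniteDimensional ℝ E]
  (g : PseudoRiemannianMetric I ∞ E (TangentSpace I : M → Type _)) [g.HasLeviCivita]
  {E' : Type*} [NormedAddCommGroup E'] [NormedSpace ℝ E'] {H' : Type*} [TopologicalSpace H']
  {I' : ModelWithCorners ℝ E' H'} {N : Type*} [TopologicalSpace N] [ChartedSpace H' N]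
  [IsManifold I' ∞ N] [FiniteDimensional ℝ E'] [I'.Boundaryless] {f : N → M} {ν : NormalField I f}

/-- **The second fundamental form of a smooth map from a (general) manifold, with smooth normal field, is a smooth section
of the bundle of bilinear forms** — the tree's `contMDiff_bilinSection_of_eq_secondFundamentalForm` with the chart domain
`U : Opens E'` replaced by any manifold `N`: componentwise in the local frame of `TN` at `y₀`
(`contMDiffAt_bilinSection_of_localFrame`, the frame fields being `C^∞` at `y₀`, `contMDiffAt_localFrame_of_mem`), each
component `y ↦ K_ν(sᵢ y, sⱼ y)` is `C^∞` (`contMDiffAt_secondFundamentalForm_apply`).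
[cite: ONeill1983, Ch. 4, Lemma 4] -/
theorem contMDiff_bilinSection_secondFundamentalForm (hf : ContMDiff I' I ∞ f)
    (hν : ContMDiff I' I.tangent ∞ (fun x ↦ (TotalSpace.mk' E (f x) (ν x) : TangentBundle I M)))
    (Kc : Π y : N, TangentSpace I' y →L[ℝ] TangentSpace I' y →L[ℝ] ℝ)
    (hKc : ∀ (y : N) (v w : TangentSpace I' y), Kc y v w = g.secondFundamentalForm I' f ν y v w) :
    ContMDiff I' (I'.prod 𝓘(ℝ, E' →L[ℝ] E' →L[ℝ] ℝ)) ∞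
      (fun y : N ↦ TotalSpace.mk' (E' →L[ℝ] E' →L[ℝ] ℝ)
        (E := fun x : N ↦ TangentSpace I' x →L[ℝ] TangentSpace I' x →L[ℝ] ℝ) y (Kc y)) := by
  intro y₀
  set b := Module.finBasis ℝ E' with hb
  refine contMDiffAt_bilinSection_of_localFrame b Kc y₀ fun i j ↦ ?_
  set e := trivializationAt E' (TangentSpace I' : N → Type _) y₀ with he
  have hfr : ∀ i, ContMDiffAt I' I'.tangent ∞
      (fun y ↦ (TotalSpace.mk' E' y (e.localFrame b i y) : TangentBundle I' N)) y₀ := fun i ↦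
    contMDiffAt_localFrame_of_mem ∞ e b i (FiberBundle.mem_baseSet_trivializationAt' y₀)
  have h := g.contMDiffAt_secondFundamentalForm_apply (I' := I') hf hν (V := e.localFrame b i)
    (W := e.localFrame b j) (y₀ := y₀) (hfr i) (hfr j)
  have hfun : (fun y ↦ Kc y (e.localFrame b i y) (e.localFrame b j y)) =
      fun y ↦ g.secondFundamentalForm I' f ν y (e.localFrame b i y) (e.localFrame b j y) :=
    funext fun y ↦ hKc y _ _
  rw [hfun]
  exact h

/-- **The induced initial data set of a spacelike immersion of a general manifold** — the tree's
`exists_initialDataSet_induced` (chart domains) for an arbitrary boundaryless data manifold `N`: for a smooth spacelike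
immersion `f : N → (M, g)` and a field `ν` normal to `f` with `C^∞` lift there is an `InitialDataSet` `D = (h, k)` on `N` with
`h = f^* g` (`inducedRiemannianMetric`, smooth by `contMDiff_pullbackBilin_holds`) and `k = K_ν` (sign `K_ν(v, w) = + g(D_v ν, df w)`;
continuous by `LinearMap.toContinuousBilinearMap`, symmetric by `secondFundamentalForm_symm_holds`, smooth by
`contMDiff_bilinSection_secondFundamentalForm`). [cite: ONeill1983, Ch. 4, Lemma 4 and Lemma 4.4]
[cite: ChoquetBruhat2009, Ch. VI, §2–3] -/
theorem exists_initialDataSet_induced_manifold (hfi : g.IsSpacelikeImmersion I' f) (hn : g.IsNormalTo I' f ν)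
    (hν : ContMDiff I' I.tangent ∞ (fun x ↦ (TotalSpace.mk' E (f x) (ν x) : TangentBundle I M))) :
    ∃ D : InitialDataSet I' N,
      D.h = g.inducedRiemannianMetric f PseudoRiemannianMetric.contMDiff_pullbackBilin_holds hfi ∧
      ∀ y : N, D.kBilin y = g.secondFundamentalForm I' f ν y := by
  haveI : CompleteSpace E := FiniteDimensional.complete ℝ E
  set Kc : Π y : N, TangentSpace I' y →L[ℝ] TangentSpace I' y →L[ℝ] ℝ :=
    fun y ↦ show E' →L[ℝ] E' →L[ℝ] ℝ from
      LinearMap.toContinuousBilinearMap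
        (show E' →ₗ[ℝ] E' →ₗ[ℝ] ℝ from g.secondFundamentalForm I' f ν y) with hKc_def
  have hKc : ∀ (y : N) (v w : TangentSpace I' y),
      Kc y v w = g.secondFundamentalForm I' f ν y v w := fun _ _ _ ↦ rfl
  have hsymm : ∀ (y : N) (v w : TangentSpace I' y),
      g.secondFundamentalForm I' f ν y v w = g.secondFundamentalForm I' f ν y w v := fun y v w ↦
    (PseudoRiemannianMetric.secondFundamentalForm_symm_holds (g := g) (I' := I') (N := N)
      (hfi.contMDiff_self.of_le (by exact WithTop.coe_le_coe.2 le_top)) hn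
      (hν.of_le (by exact WithTop.coe_le_coe.2 le_top)) (y := y) BoundarylessManifold.isInteriorPoint).eq v w
  refine ⟨{ h := g.inducedRiemannianMetric f PseudoRiemannianMetric.contMDiff_pullbackBilin_holds hfi
            k := Kc
            k_symm := fun y v w ↦ by rw [hKc, hKc]; exact hsymm y v w
            contMDiff_k := contMDiff_bilinSection_secondFundamentalForm g hfi.contMDiff_self hν Kc hKc },
    rfl, fun y ↦ ?_⟩
  exact LinearMap.ext₂ fun v w ↦ hKc y v w

end InducedData

/-! #### (β3) The future unit normal of a re-slice agrees with the old one off the gauge set. -/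
section NormalOff

universe u

variable {n : ℕ} {X : Type u} [TopologicalSpace X] [ChartedSpace (EuclideanSpace ℝ (Fin n)) X] [IsManifold (𝓡 n) ∞ X]
  [T2Space X] [ConnectedSpace X] {D : InitialDataSet (𝓡 n) X}

/-- **The future unit normal off the gauge set is the old one**: for a data embedding `𝒮 = (M, g, τ, ι₀, N₀)` and a map
`ι : X → M` with a future unit normal field `ν`, if `ι = ι₀` off a compact set `K`, then at every `x ∉ K` the differentials
agree (`ι =ᶠ ι₀` near `x` since `X ∖ K` is open, `Filter.EventuallyEq.mfderiv_eq`), so `ν x` and `N₀ x` are future unit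
normals to the same spacelike hyperplane `dι₀(T_x X)` and coincide (`TimeOrientation.eq_of_isFutureUnitNormal`) — as an
equation of model-fibre vectors in `ℝⁿ⁺¹`. [cite: ONeill1983, Ch. 5, Lemma 5.26] -/
theorem dataEmbedding_normal_eq_of_embed_eq_off (𝒮 : DataEmbedding D)
    {ι : X → 𝒮.carrier} {ν : NormalField (𝓡 (n + 1)) ι}
    (hν : 𝒮.metric.IsFutureUnitNormal (𝓡 n) 𝒮.timeOrientation ι ν) {K : Set X} (hK : IsCompact K)
    (hagree : ∀ x, x ∉ K → ι x = 𝒮.embed x) {x : X} (hx : x ∉ K) :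
    (ν x : EuclideanSpace ℝ (Fin (n + 1))) = (𝒮.normal x : EuclideanSpace ℝ (Fin (n + 1))) := by
  have hev : ι =ᶠ[𝓝 x] 𝒮.embed :=
    (hK.isClosed.isOpen_compl.eventually_mem hx).mono fun z hz ↦ hagree z hz
  have hchain : mfderiv (𝓡 n) (𝓡 (n + 1)) ι x = mfderiv (𝓡 n) (𝓡 (n + 1)) 𝒮.embed x := hev.mfderiv_eq
  exact 𝒮.timeOrientation.eq_of_isFutureUnitNormal (hagree x hx).symm (mfderiv (𝓡 n) (𝓡 (n + 1)) 𝒮.embed x)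
    (fun v hv ↦ 𝒮.val_mfderiv_embed_pos x hv) (DataEmbedding.finrank_tangentSpace_add_one x)
    (𝒮.isFutureUnitNormal.1.1 x) (𝒮.isFutureUnitNormal.1.2 x) (𝒮.isFutureUnitNormal.2 x)
    (fun v ↦ by rw [← hchain]; exact hν.1.1 x v) (hν.1.2 x) (hν.2 x)

end NormalOff

end Summit.FinalStateConjecture.FinalStateConjecture.Theorems.SpacelikeSliceInducedData
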